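import Summits.Ventures.PercRepro.Night2LocalD2FarPre

/-!
# PercRepro — the rule R1₄ for the coloop cell of the (6,4) row: definitions and rows (night-2, gen 15)

The last cell of the (6,4) shadow row is `|E ∖ G| = 2` with ONE coloop `y` of `M|G` (NIGHT-2-k1.md): the members are
the «layer-0» sets `B ⊆ P := G ∖ y` spanning `P` (`|G ∖ cl B| = 1`, demand `2/5`, the single covering set `B ∪ {y}`)
and the sets `K ∪ {y}` with `K ⊆ P` of rank `3` (`m := |G ∖ cl B| = |P ∖ cl K| ≥ 2`, demand `(6/5)·m/(m+2)`).

**The rule R1₄** (the rank-4 analogue of R1, NIGHT-2-r1.md §2; numerics NIGHT-2-k1.md §2: 0 overloads on 241 instances):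
* a member with `m ≥ 2` puts `r14Cov` on each covering set `B ∪ {z}` — `4/25` when `m ≤ 4`, `(6/5)/(m+2)` when `m ≥ 5` —
  and `r14Pair` on each pair set `B ∪ {z, z'}` (`7/25`, `2/25`, `2/75` for `m = 2, 3, 4`; `0` for `m ≥ 5`);
* a layer-0 member with `|B| ≥ 5` puts `2/5` on its covering set;
* a layer-0 member with `|B| = 4` (a basis of `P`) keeps `r14Keep = max 0 (min (2/5) (1 − σ⁺(B)))` on its covering set,
  where `σ⁺(B) = r14Sigma` is the covering weight its member faces `(B ∖ z) ∪ (G ∖ cl B)` put there, and spreads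
  `(2/5 − r14Keep)/|cl B ∖ B|` on each `B ∪ (G ∖ cl B) ∪ {x}`, `x ∈ cl B ∖ B`.

This file defines the rule and proves its rows are EXACT (`row_r14W_eq`: `Σ_S w(B, S) = (6/5)·localWeight`) and the
conditional assembly **`localShadowHall_of_r14W_columns`**: if every column is `≤ 1`, (LI_G) holds.  The column bounds
(the «solid problem») are the successor's work.
-/

namespace PercRepro.Shadow

open Finset PerFlat ThmH

variable {α : Type*} [DecidableEq α] {M : Matroid α} [M.Finite]

/-! ## The rule -/

/-- The covering weight of a member with `m = |G ∖ cl B| ≥ 2`: `4/25` for `m ≤ 4`, `(6/5)/(m+2)` for `m ≥ 5`. -/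
noncomputable def r14Cov (M : Matroid α) [M.Finite] (G B : Finset α) : ℚ :=
  if (G \ clF M B).card ≤ 4 then 4 / 25 else (6 / 5) / (((G \ clF M B).card : ℚ) + 2)

/-- The pair weight of a member with `2 ≤ m ≤ 4`: `((6/5)·m/(m+2) − 4m/25)/C(m,2)`; `0` for `m ≥ 5`. -/
noncomputable def r14Pair (M : Matroid α) [M.Finite] (G B : Finset α) : ℚ :=
  if (G \ clF M B).card ≤ 4 then
    ((6 / 5) * ((G \ clF M B).card : ℚ) / (((G \ clF M B).card : ℚ) + 2) - ((G \ clF M B).card : ℚ) * (4 / 25)) /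
      (((G \ clF M B).card.choose 2 : ℕ) : ℚ)
  else 0

open scoped Classical in
/-- `σ⁺(B)` of a layer-0 member: the covering weights of its member faces `(B ∖ z) ∪ (G ∖ cl B)`, `z ∈ B`. -/
noncomputable def r14Sigma (M : Matroid α) [M.Finite] (G B : Finset α) : ℚ :=
  ∑ z ∈ B, (if (B.erase z) ∪ (G \ clF M B) ∈ membersIn M (Uq M (4 + 2) 4) G then
    r14Cov M G ((B.erase z) ∪ (G \ clF M B)) else 0)

open scoped Classical in
/-- What a layer-0 basis keeps on its covering set: `max 0 (min (2/5) (1 − σ⁺(B)))`. -/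
noncomputable def r14Keep (M : Matroid α) [M.Finite] (G B : Finset α) : ℚ :=
  max 0 (min (2 / 5) (1 - r14Sigma M G B))

open scoped Classical in
/-- **The rule R1₄** `w(B, S)`. -/
noncomputable def r14W (M : Matroid α) [M.Finite] (G B S : Finset α) : ℚ :=
  if B ∈ membersIn M (Uq M (4 + 2) 4) G then
    (if (G \ clF M B).card = 1 then
      (if 5 ≤ B.card then (if S ∈ coverSets M B G then 2 / 5 else 0)
       else (if S ∈ coverSets M B G then r14Keep M G B else 0) +
         ∑ x ∈ clF M B \ B, (if S = insert x (B ∪ (G \ clF M B)) then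
           (2 / 5 - r14Keep M G B) / ((clF M B \ B).card : ℚ) else 0))
     else
      (if S ∈ coverSets M B G then r14Cov M G B else 0) +
        ∑ P ∈ Finset.powersetCard 2 (G \ clF M B), (if S = B ∪ P then r14Pair M G B else 0))
  else 0

/-! ## Basic facts -/

/-- `0 ≤ r14Cov`. -/
theorem r14Cov_nonneg (G B : Finset α) : 0 ≤ r14Cov M G B := by
  unfold r14Cov
  split_ifs <;> positivity

/-- `r14Cov ≤ 6/35` (for `m ≥ 5` the weight `(6/5)/(m+2)` is at most `6/35`; `4/25 < 6/35`). -/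
theorem r14Cov_le (G B : Finset α) : r14Cov M G B ≤ 6 / 35 := by
  unfold r14Cov
  split_ifs with h
  · norm_num
  · push Not at h
    have h5 : (5 : ℚ) ≤ ((G \ clF M B).card : ℚ) := by exact_mod_cast h
    rw [div_le_div_iff₀ (by positivity) (by norm_num)]
    linarith

/-- `0 ≤ r14Pair` (the numerator `(6/5)·m/(m+2) − 4m/25` is nonnegative for `m ≤ 4`). -/
theorem r14Pair_nonneg (G B : Finset α) : 0 ≤ r14Pair M G B := by
  unfold r14Pair
  split_ifs with h
  · apply div_nonneg _ (Nat.cast_nonneg _)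
    have hm : ((G \ clF M B).card : ℚ) ≤ 4 := by exact_mod_cast h
    have hm0 : (0 : ℚ) ≤ ((G \ clF M B).card : ℚ) := Nat.cast_nonneg _
    have key : ((G \ clF M B).card : ℚ) * (4 / 25) ≤ (6 / 5) * ((G \ clF M B).card : ℚ) / (((G \ clF M B).card : ℚ) + 2) := by
      rw [le_div_iff₀ (by positivity)]
      nlinarith
    linarith
  · exact le_refl _

/-- `0 ≤ r14Keep`. -/
theorem r14Keep_nonneg (G B : Finset α) : 0 ≤ r14Keep M G B := le_max_left _ _

/-- `r14Keep ≤ 2/5`. -/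
theorem r14Keep_le (G B : Finset α) : r14Keep M G B ≤ 2 / 5 := by
  unfold r14Keep
  apply max_le (by norm_num)
  exact min_le_left _ _

open scoped Classical in
/-- `0 ≤ r14W`. -/
theorem r14W_nonneg (G B S : Finset α) : 0 ≤ r14W M G B S := by
  unfold r14W
  by_cases h1 : B ∈ membersIn M (Uq M (4 + 2) 4) G
  · simp only [h1, if_true]
    by_cases h2 : (G \ clF M B).card = 1
    · simp only [h2, if_true]
      by_cases h3 : 5 ≤ B.card
      · simp only [h3, if_true]
        split_ifs <;> norm_num
      · simp only [h3, if_false]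
        refine add_nonneg ?_ (Finset.sum_nonneg (fun x _ => ?_))
        · split_ifs
          · exact r14Keep_nonneg G B
          · exact le_refl _
        · split_ifs
          · exact div_nonneg (by linarith [r14Keep_le (M := M) G B]) (by positivity)
          · exact le_refl _
    · simp only [h2, if_false]
      refine add_nonneg ?_ (Finset.sum_nonneg (fun P _ => ?_))
      · split_ifs
        · exact r14Cov_nonneg G B
        · exact le_refl _
      · split_ifs
        · exact r14Pair_nonneg G B
        · exact le_refl _
  · simp only [h1, if_false, le_refl]

open scoped Classical in
/-- A nonzero weight `w(B, S)` has `B ⊆ S`. -/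
theorem subset_of_r14W_ne_zero {G B S : Finset α} (h : r14W M G B S ≠ 0) : B ⊆ S := by
  unfold r14W at h
  by_cases h1 : B ∈ membersIn M (Uq M (4 + 2) 4) G
  · simp only [h1, if_true] at h
    have hcov : S ∈ coverSets M B G → B ⊆ S := by
      intro hc
      obtain ⟨z, -, rfl⟩ := mem_coverSets.1 hc
      exact Finset.subset_insert _ _
    by_cases h2 : (G \ clF M B).card = 1
    · simp only [h2, if_true] at h
      by_cases h3 : 5 ≤ B.card
      · simp only [h3, if_true] at h
        by_cases hc : S ∈ coverSets M B G
        · exact hcov hc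
        · simp only [hc, if_false] at h
          exact absurd rfl h
      · simp only [h3, if_false] at h
        by_cases hc : S ∈ coverSets M B G
        · exact hcov hc
        · simp only [hc, if_false, zero_add] at h
          obtain ⟨x, -, hne⟩ := Finset.exists_ne_zero_of_sum_ne_zero h
          by_cases hS : S = insert x (B ∪ (G \ clF M B))
          · rw [hS]
            exact Finset.subset_union_left.trans (Finset.subset_insert _ _)
          · simp only [hS, if_false] at hne
            exact absurd rfl hne
    · simp only [h2, if_false] at h
      by_cases hc : S ∈ coverSets M B G
      · exact hcov hc
      · simp only [hc, if_false, zero_add] at h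
        obtain ⟨P, -, hne⟩ := Finset.exists_ne_zero_of_sum_ne_zero h
        by_cases hS : S = B ∪ P
        · rw [hS]; exact Finset.subset_union_left
        · simp only [hS, if_false] at hne
          exact absurd rfl hne
  · simp only [h1, if_false] at h
    exact absurd rfl h

/-! ## Rows -/

/-- A member with `|G ∖ cl B| = 1` below a flat with `|E ∖ G| = 2` has `|cl B ∖ B| ≥ 3`
(`6 = ρ(E ∖ B) ≤ ρ(E ∖ cl B) + |cl B ∖ B| ≤ 3 + |cl B ∖ B|`). -/
theorem three_le_card_clF_sdiff {G : Finset α} (hGg : G ⊆ gr M) (hd : (gr M \ G).card = 2) {B : Finset α}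
    (hB : B ∈ membersIn M (Uq M (4 + 2) 4) G) (hm : (G \ clF M B).card = 1) : 3 ≤ (clF M B \ B).card := by
  have hBU : B ∈ Uq M (4 + 2) 4 := (mem_membersIn.1 hB).1
  have h6 := rkN_sdiff_eq_of_mem_Uq hBU
  have hc : (gr M \ clF M B).card = 3 := by
    rw [card_sdiff_clF_eq_add hGg (mem_membersIn.1 hB).2, hm, hd]
  have hsub : gr M \ B ⊆ (gr M \ clF M B) ∪ (clF M B \ B) := by
    intro e he
    rw [Finset.mem_sdiff] at he
    rw [Finset.mem_union, Finset.mem_sdiff, Finset.mem_sdiff]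
    by_cases hecl : e ∈ clF M B
    · right; exact ⟨hecl, he.2⟩
    · left; exact ⟨he.1, hecl⟩
  have h1 := rkN_mono (M := M) hsub
  have h2 := rkN_union_le_rkN_add_card (M := M) (gr M \ clF M B) (clF M B \ B)
  have h3 := rkN_le_card_fin (M := M) (gr M \ clF M B)
  omega

open scoped Classical in
/-- The covering set of a layer-0 member is `B ∪ (G ∖ cl B)`, a shadow set, and its supersets `insert x` (`x ∈ G`) are
shadow sets. -/
theorem union_sdiff_mem_shadowAt_of_card_one {G : Finset α} (hG : G ∈ flatsQ M (4 + 1)) {B : Finset α}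
    (hB : B ∈ membersIn M (Uq M (4 + 2) 4) G) (hm : (G \ clF M B).card = 1) :
    B ∪ (G \ clF M B) ∈ shadowAt M (4 + 2) 4 (Uq M (4 + 2) 4) G := by
  obtain ⟨y, hy⟩ := Finset.card_eq_one.1 hm
  apply coverSets_subset_shadowAt (le_refl _) hG hB
  rw [mem_coverSets]
  refine ⟨y, by rw [hy]; exact Finset.mem_singleton_self y, ?_⟩
  rw [hy, Finset.insert_eq, Finset.union_comm]

open scoped Classical in
/-- The row of a member with `|G ∖ cl B| = 1`, `|B| ≥ 5`. -/
theorem sum_r14W_row_five {G : Finset α} (hG : G ∈ flatsQ M (4 + 1)) {B : Finset α}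
    (hB : B ∈ membersIn M (Uq M (4 + 2) 4) G) (hm : (G \ clF M B).card = 1) (h5 : 5 ≤ B.card) :
    ∑ S ∈ shadowAt M (4 + 2) 4 (Uq M (4 + 2) 4) G, r14W M G B S = 2 / 5 := by
  have hBU : B ∈ Uq M (4 + 2) 4 := (mem_membersIn.1 hB).1
  unfold r14W
  simp only [hB, hm, h5, if_true]
  rw [← Finset.sum_filter]
  have h1 : (shadowAt M (4 + 2) 4 (Uq M (4 + 2) 4) G).filter (fun S => S ∈ coverSets M B G) = coverSets M B G := by
    ext S
    rw [Finset.mem_filter]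
    exact ⟨fun h => h.2, fun h => ⟨coverSets_subset_shadowAt (le_refl _) hG hB h, h⟩⟩
  rw [h1, Finset.sum_const, card_coverSets hBU, hm, one_smul]

open scoped Classical in
/-- The row of a layer-0 basis (`|G ∖ cl B| = 1`, `|B| < 5`): keep plus spread is `2/5`. -/
theorem sum_r14W_row_four {G : Finset α} (hG : G ∈ flatsQ M (4 + 1)) (hd : (gr M \ G).card = 2) {B : Finset α}
    (hB : B ∈ membersIn M (Uq M (4 + 2) 4) G) (hm : (G \ clF M B).card = 1) (h5 : ¬ 5 ≤ B.card) :
    ∑ S ∈ shadowAt M (4 + 2) 4 (Uq M (4 + 2) 4) G, r14W M G B S = 2 / 5 := by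
  have hGg : G ⊆ gr M := (mem_flatsQ.1 hG).1
  have hBU : B ∈ Uq M (4 + 2) 4 := (mem_membersIn.1 hB).1
  have hcl : clF M B ⊆ G := (mem_membersIn.1 hB).2
  have h3 := three_le_card_clF_sdiff hGg hd hB hm
  have hpos : (0 : ℚ) < ((clF M B \ B).card : ℚ) := by exact_mod_cast (by omega : 0 < (clF M B \ B).card)
  unfold r14W
  simp only [hB, hm, h5, if_true, if_false]
  rw [Finset.sum_add_distrib]
  have hA : ∑ S ∈ shadowAt M (4 + 2) 4 (Uq M (4 + 2) 4) G, (if S ∈ coverSets M B G then r14Keep M G B else 0) =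
      r14Keep M G B := by
    rw [← Finset.sum_filter]
    have h1 : (shadowAt M (4 + 2) 4 (Uq M (4 + 2) 4) G).filter (fun S => S ∈ coverSets M B G) = coverSets M B G := by
      ext S
      rw [Finset.mem_filter]
      exact ⟨fun h => h.2, fun h => ⟨coverSets_subset_shadowAt (le_refl _) hG hB h, h⟩⟩
    rw [h1, Finset.sum_const, card_coverSets hBU, hm, one_smul]
  have hsh := union_sdiff_mem_shadowAt_of_card_one hG hB hm
  have hBs : ∑ S ∈ shadowAt M (4 + 2) 4 (Uq M (4 + 2) 4) G, ∑ x ∈ clF M B \ B,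
      (if S = insert x (B ∪ (G \ clF M B)) then (2 / 5 - r14Keep M G B) / ((clF M B \ B).card : ℚ) else 0) =
      2 / 5 - r14Keep M G B := by
    rw [Finset.sum_comm]
    have h2 : ∀ x ∈ clF M B \ B, ∑ S ∈ shadowAt M (4 + 2) 4 (Uq M (4 + 2) 4) G,
        (if S = insert x (B ∪ (G \ clF M B)) then (2 / 5 - r14Keep M G B) / ((clF M B \ B).card : ℚ) else 0) =
        (2 / 5 - r14Keep M G B) / ((clF M B \ B).card : ℚ) := by
      intro x hx
      rw [Finset.sum_ite_eq']
      have hxG : x ∈ G := hcl (Finset.mem_sdiff.1 hx).1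
      simp only [insert_mem_shadowAt_of_mem hG hsh hxG, if_true]
    rw [Finset.sum_congr rfl h2, Finset.sum_const, nsmul_eq_mul]
    field_simp
  rw [hA, hBs]
  ring

open scoped Classical in
/-- The row of a member with `|G ∖ cl B| ≥ 2`: `m · r14Cov + C(m,2) · r14Pair`. -/
theorem sum_r14W_row_ge_two {G : Finset α} (hG : G ∈ flatsQ M (4 + 1)) {B : Finset α}
    (hB : B ∈ membersIn M (Uq M (4 + 2) 4) G) (hm : ¬ (G \ clF M B).card = 1) :
    ∑ S ∈ shadowAt M (4 + 2) 4 (Uq M (4 + 2) 4) G, r14W M G B S =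
      ((G \ clF M B).card : ℚ) * r14Cov M G B + (((G \ clF M B).card.choose 2 : ℕ) : ℚ) * r14Pair M G B := by
  have hBU : B ∈ Uq M (4 + 2) 4 := (mem_membersIn.1 hB).1
  unfold r14W
  simp only [hB, hm, if_true, if_false]
  rw [Finset.sum_add_distrib]
  congr 1
  · rw [← Finset.sum_filter]
    have h1 : (shadowAt M (4 + 2) 4 (Uq M (4 + 2) 4) G).filter (fun S => S ∈ coverSets M B G) = coverSets M B G := by
      ext S
      rw [Finset.mem_filter]
      exact ⟨fun h => h.2, fun h => ⟨coverSets_subset_shadowAt (le_refl _) hG hB h, h⟩⟩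
    rw [h1, Finset.sum_const, card_coverSets hBU, nsmul_eq_mul]
  · rw [Finset.sum_comm]
    have h2 : ∀ P ∈ Finset.powersetCard 2 (G \ clF M B),
        ∑ S ∈ shadowAt M (4 + 2) 4 (Uq M (4 + 2) 4) G, (if S = B ∪ P then r14Pair M G B else 0) =
          r14Pair M G B := by
      intro P hP
      rw [Finset.sum_ite_eq']
      simp only [union_pair_mem_shadowAt (le_refl _) hG hB hP, if_true]
    rw [Finset.sum_congr rfl h2, Finset.sum_const, Finset.card_powersetCard, nsmul_eq_mul]

/-- The arithmetic of the rows for `m ≥ 2`: `m·r14Cov + C(m,2)·r14Pair = (6/5)·m/(m+2)`. -/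
theorem r14_row_arith {G B : Finset α} (hm : 2 ≤ (G \ clF M B).card) :
    ((G \ clF M B).card : ℚ) * r14Cov M G B + (((G \ clF M B).card.choose 2 : ℕ) : ℚ) * r14Pair M G B =
      (6 / 5) * ((G \ clF M B).card : ℚ) / (((G \ clF M B).card : ℚ) + 2) := by
  unfold r14Cov r14Pair
  obtain ⟨m, hmm⟩ : ∃ m, (G \ clF M B).card = m := ⟨_, rfl⟩
  rw [hmm] at hm ⊢
  by_cases h4 : m ≤ 4
  · simp only [h4, if_true]
    have hpos : ((m.choose 2 : ℕ) : ℚ) ≠ 0 := by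
      have : 0 < m.choose 2 := Nat.choose_pos hm
      exact_mod_cast this.ne'
    field_simp
    ring
  · simp only [h4, if_false, mul_zero, add_zero]
    push Not at h4
    have hpos : (0 : ℚ) < (m : ℚ) + 2 := by positivity
    field_simp

open scoped Classical in
/-- **The rows of R1₄ are exact**: `Σ_S w(B, S) = (6/5)·localWeight M B G` for every member (`|E ∖ G| = 2`). -/
theorem row_r14W_eq {G : Finset α} (hG : G ∈ flatsQ M (4 + 1)) (hd : (gr M \ G).card = 2) {B : Finset α}
    (hB : B ∈ membersIn M (Uq M (4 + 2) 4) G) :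
    ∑ S ∈ shadowAt M (4 + 2) 4 (Uq M (4 + 2) 4) G, r14W M G B S =
      (((4 : ℕ) : ℚ) + 2) / (((4 : ℕ) : ℚ) + 1) * localWeight M B G := by
  have hGg : G ⊆ gr M := (mem_flatsQ.1 hG).1
  have hBU : B ∈ Uq M (4 + 2) 4 := (mem_membersIn.1 hB).1
  have hc : (gr M \ clF M B).card = (G \ clF M B).card + 2 := by
    rw [card_sdiff_clF_eq_add hGg (mem_membersIn.1 hB).2, hd]
  have hm1 : 1 ≤ (G \ clF M B).card := by
    by_contra h
    push Not at h
    have h0 : G \ clF M B = ∅ := Finset.card_eq_zero.1 (by omega)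
    rw [Finset.sdiff_eq_empty_iff_subset] at h0
    have h1 := rkN_mono (M := M) h0
    rw [rkN_clF_eq_of_mem_Uq hBU] at h1
    have h2 : rkN M G = 4 + 1 := by
      unfold rkN; rw [(mem_flatsQ.1 hG).2.2]; rfl
    omega
  unfold localWeight
  rw [hc]
  by_cases hm : (G \ clF M B).card = 1
  · rw [hm]
    by_cases h5 : 5 ≤ B.card
    · rw [sum_r14W_row_five hG hB hm h5]; norm_num
    · rw [sum_r14W_row_four hG hd hB hm h5]; norm_num
  · rw [sum_r14W_row_ge_two hG hB hm, r14_row_arith (by omega)]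
    push_cast
    ring

/-! ## The conditional assembly -/

open scoped Classical in
/-- **(LI_G) follows from the column bounds of R1₄** at a rank-5 flat with `|E ∖ G| = 2`. -/
theorem localShadowHall_of_r14W_columns {G : Finset α} (hG : G ∈ flatsQ M (4 + 1)) (hd : (gr M \ G).card = 2)
    (hcol : ∀ S ∈ shadowAt M (4 + 2) 4 (Uq M (4 + 2) 4) G, ∑ B ∈ membersIn M (Uq M (4 + 2) 4) G, r14W M G B S ≤ 1) :
    LocalShadowHall M 4 G := by
  apply localShadowHall_of_full_matching (r14W M G)
  · intro B S
    exact r14W_nonneg G B S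
  · intro B S h
    exact subset_of_r14W_ne_zero h
  · exact hcol
  · intro B hB
    rw [row_r14W_eq hG hd hB]

end PercRepro.Shadow
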